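import Mathlib
import Summits.NavierStokesRegularity.NavierStokesRegularity.Theses.SlicedKelvin
import Summits.NavierStokesRegularity.NavierStokesRegularity.Theorems.SlicedKelvinFluxZoomStubSubslabBounds
import Summits.NavierStokesRegularity.NavierStokesRegularity.Theorems.SlicedKelvinFluxZoomStubNearFieldFlux
import Summits.NavierStokesRegularity.NavierStokesRegularity.Theorems.SlicedKelvinFluxZoomStubUnitScaleVelocity
import Summits.NavierStokesRegularity.NavierStokesRegularity.Theorems.SlicedKelvinFluxZoomStubFluxVelocity
import Summits.NavierStokesRegularity.NavierStokesRegularity.Theorems.SlicedKelvinFluxZoomStubOseenBoxRegularity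
import Summits.NavierStokesRegularity.NavierStokesRegularity.Theorems.SlicedKelvinFluxZoomStubOseenAncientMild
import Summits.NavierStokesRegularity.NavierStokesRegularity.Theorems.SlicedKelvinFluxZoomStubFderivLimit
import Summits.NavierStokesRegularity.NavierStokesRegularity.Theorems.SlicedKelvinFluxZoomStubOseenWindowShift
import Summits.NavierStokesRegularity.NavierStokesRegularity.Theorems.SlicedKelvinFluxZoomStubSliceFDerivContinuous
import Summits.NavierStokesRegularity.NavierStokesRegularity.Theorems.SlicedKelvinFluxZoomStubZoomBookkeeping
import Summits.NavierStokesRegularity.NavierStokesRegularity.Theorems.SlicedKelvinFluxZoomStubViscosityNormalization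
import Summits.NavierStokesRegularity.NavierStokesRegularity.Theorems.SlicedKelvinFluxZoomStubZoomCoreUnit

/-!
# Route SlicedKelvin — `FluxZoom` (crux item stmt-NavierStokesRegularity-15603), proved

The crux `Theses.SlicedKelvin.FluxZoom` (vorticity-record zoom at bounded planar flux): a classical
solution of the unforced Navier–Stokes system (`ν > 0`) on `ℝ³ × [0, T)`, Leray–Hopf from its rapidly
decaying datum, with NO smooth extension past `T` but unsigned planar vorticity flux `≤ M` on `[0, T)`,
produces a bounded ancient mild solution `v` (`ν = 1`), with measurable slices, jointly smooth on
`(−∞, 0) × ℝ³`, with bounded planar flux on every plane and slice, NON-CONSTANT on some slice `t < 0`.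

## Proof (the line `registered` of the crux, skeleton `Cruxes/FluxZoom/Lines/birth.lean`, all stubs landed)

1. `stub_subslabBounds`: sup-form Beale–Kato–Majda (bounded vorticity on `[0, T) × ℝ³` ⇒ smooth
   extension; Tao 2013 + `beale_kato_majda_holds`) turns `¬HasSmoothExtensionPast` into "vorticity
   unbounded on `[0, T)`", and gives velocity / vorticity bounds on every closed sub-slab.
2. `stub_fluxVelocity (stub_unitScaleVelocity stub_nearFieldFlux)`: `‖u‖²_∞ ≤ (12/π)‖ω‖_∞ Φ` for `C²`
   divergence-free `u ∈ L²` with planar flux `≤ Φ` (local Helmholtz identity at a point, planar slicing of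
   the near field, NS scaling) — the velocity bound that makes the vorticity-normalised zoom bounded.
3. `stub_viscosityNormalization (stub_zoomCoreUnit …)`: the vorticity-clock KNSS zoom (`ν` normalised to
   `1`; near-records; rescaled classical solutions Oseen-mild by `mild_of_bounded_of_eLpNorm_two_le_of_lt`;
   compactness `KNSS2009_lemma61_oseenMild`; the limit is a bounded ancient mild solution
   (`stub_oseenAncientMild`), jointly smooth (`stub_oseenBoxRegularity`, `stub_oseenWindowShift`), its
   vorticity is the pointwise limit of the vorticities (`stub_fderivLimit`), so the flux bound passes to the
   limit by Fatou and the record `|curl v_n(0,0)| = 1` survives as `curl v(s₀, 0) ≠ 0` at a fixed `s₀ < 0`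
   (`stub_sliceFDerivContinuous`)).
4. A slice with a point of non-zero curl is not spatially constant (`curl_eq_zero_of_fderiv_eq_zero`).

Unconditional: no named fact is taken as a hypothesis; axioms `propext`, `Classical.choice`, `Quot.sound`.
-/

noncomputable section

open Set MeasureTheory Filter Topology

-- the summit and its single sub-problem share the name (CONVENTIONS §1), as in every Theorems file
set_option linter.dupNamespace false

namespace Summit.NavierStokesRegularity.NavierStokesRegularity.Theorems

open Literature.Analysis.FluidPDE

/-- **`FluxZoom` holds** (route SlicedKelvin, crux item stmt-NavierStokesRegularity-15603): the
vorticity-record zoom at bounded planar flux produces a bounded ancient mild solution (`ν = 1`),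
measurable and jointly smooth on `(−∞, 0) × ℝ³`, with bounded planar flux, non-constant on some slice
`t < 0`. Composition of the landed stubs of the line `registered` (module docstring). -/
theorem slicedKelvin_fluxZoom_proof :
    Summit.NavierStokesRegularity.NavierStokesRegularity.Theses.SlicedKelvin.FluxZoom := by
  intro ν T hν hT u p hcl hLH hdec hne hflux
  obtain ⟨hbkm, hsub⟩ := FluxZoom.Registered.stub_subslabBounds ν T hν hT u p hcl hLH hdec
  have hunb : ¬ ∃ W : ℝ, ∀ t ∈ Set.Ico 0 T, ∀ x, ‖curl (u t) x‖ ≤ W := fun hW => hne (hbkm hW)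
  have hcore := FluxZoom.Registered.stub_viscosityNormalization
    (FluxZoom.Registered.stub_zoomCoreUnit
      (FluxZoom.Registered.stub_fluxVelocity
        (FluxZoom.Registered.stub_unitScaleVelocity FluxZoom.Registered.stub_nearFieldFlux))
      (FluxZoom.Registered.stub_oseenWindowShift FluxZoom.Registered.stub_oseenBoxRegularity)
      FluxZoom.Registered.stub_oseenAncientMild FluxZoom.Registered.stub_fderivLimit
      FluxZoom.Registered.stub_sliceFDerivContinuous FluxZoom.Registered.stub_zoomBookkeeping)
  obtain ⟨v, M', hv, hmeas, hsm, hfl, t, ht, x, hx⟩ :=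
    hcore ν T hν hT u p hcl hLH hdec hflux hsub hunb
  refine ⟨v, M', hv, hmeas, hsm, hfl, t, ht, ?_⟩
  rintro ⟨b, hb⟩
  apply hx
  have hconst : v t = fun _ => b := funext hb
  rw [hconst]
  exact curl_eq_zero_of_fderiv_eq_zero (by simp)

end Summit.NavierStokesRegularity.NavierStokesRegularity.Theorems

end
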